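import Mathlib
import Literature.MathematicalPhysics.QuantumLattice.WilsonDiracAP
import Summits.QuantumFields.QCD.Theorems.WilsonQuarkChessboardFlatCellOptimalStubWardKernelAllN
import Summits.QuantumFields.QCD.Theorems.WilsonQuarkChessboardFlatCellOptimalStubGaugeCoerciveAllN
import Summits.QuantumFields.QCD.Theorems.WilsonQuarkChessboardFlatCellOptimalStubMassLipschitzAllN
import Summits.QuantumFields.QCD.Theorems.WilsonQuarkChessboardFlatCellOptimalStubBlockMarginsAllN
import Summits.QuantumFields.QCD.Theorems.WilsonQuarkChessboardFlatCellOptimalStubTwistCountingAllM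
import Summits.QuantumFields.QCD.Theorems.WilsonQuarkChessboardFlatCellOptimalStubTadpoleAllN
import Summits.QuantumFields.QCD.Theorems.WilsonQuarkChessboardFlatCellOptimalStubFreeBlochBlocksAllN
import Summits.QuantumFields.QCD.Theorems.WilsonQuarkChessboardFlatCellOptimalStubBilinearBoundsAllN
import Summits.QuantumFields.QCD.Theorems.QuarksAsStableActionCriticalLineDiamagnetismStubBlochLatticeSum
import Summits.QuantumFields.QCD.Theorems.QuarksAsStableActionCriticalLineDiamagnetismHessianMarginOfStubsAux
import Summits.QuantumFields.QCD.Theorems.QuarksAsStableActionCriticalLineDiamagnetismStubTilingCombinatorics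
import Summits.QuantumFields.QCD.Theorems.QuarksAsStableActionCriticalLineDiamagnetismStubCellGainCore
import Summits.QuantumFields.QCD.Theorems.WilsonQuarkChessboardFlatCellOptimalStubHessianMarginAssemblyAuxAllN

/-!
# G2 — the one-loop Hessian margin for every colour number `N` and every half-side `M ≥ 2`
(closes the registered stub `stub_hessianMarginAllN` of crux stmt-QuantumFields-9307 `FlatCellOptimal`,
line `registered`, skeleton v3 `Cruxes/FlatCellOptimal/Lines/birth.lean`; assembly wave 10)

What.  On the `(2M)⁴` torus with the twisted block background `ω = e^{iπ/(2M)}·1`,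
`ζ_k(μ) = e^{iπ k_μ/M}·1 ∈ U(N)` (Bloch angles `θ_{k,μ} = π k_μ/M + π/(2M) ∈ (0, π)`), free `r = 1`
Wilson–Dirac blocks `B⁰_k = D₂[ζ_k ω](m)` on `(ℤ/2)⁴ × Fin N × Fin 4` and hopping perturbations `Δ_k`
(both universally quantified with their defining equations, exactly as registered), for every
anti-Hermitian tiling-odd block link field `Y : Edge 4 2 → M_N(ℂ)`:
`c′ · M⁴ · 𝒦(Y) ≤ ½ Σ_k Re tr (B⁰_k⁻¹ Δ_k Y B⁰_k⁻¹ Δ_k Y) + ½ Σ_μ T_μ ‖Y‖²_μ`,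
`T_μ = Σ_k Re tr (B⁰_k⁻¹ Δ_k tst_μ)`, `tst_μ = (1/N)·1` on the link `(0, μ)`, `𝒦(Y) = Σ_p ‖curl Y_p‖²_F`,
with `c′ = 3/80000`, `ε = min ε_Σ (1/(80000 (9 max C_Σ 0 + 5)))` (`C_Σ, ε_Σ` the constants of the
antiperiodic lattice sum `stub_blochLatticeSum`), for EVERY `N : ℕ`, EVERY `M ≥ 2` and `|m| ≤ ε` —
the sibling crux stmt-QuantumFields-9734's certified `stub_hessianMargin` (`N = 3`, `M ≥ 1000`) with
`Fin 3 ↦ Fin N`, `tst := (1/N)•1` and no threshold `M₀`.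

How.  The sibling's composition `stub_hessianMarginOfStubsV2` ported verbatim to the `N`-colour
inputs landed for this crux (namespaces `…FlatCellOptimal.*`): (a) the tadpole `stub_tadpoleAllN`
rewrites the right side as `Σ_k Q_k(Y)`, `Q_k(Y) = ½𝔅_k(Y,Y) − ½ℓ_k(Y⋆Y)`; (b) the Ward identity
`stub_wardKernelAllN` + additivity of `Δ` (`stub_bilinearBoundsAllN`) give `Q_k(Y) = Q_k(Y − dλ)`
(`HessianMarginOf.hessian_gauge_invariance`), and `GaugeCoercive.gaugeCoercive` chooses `λ` with
`8‖Y − dλ‖² ≤ 𝒦(Y)`; (c) `stub_massLipschitzAllN` with the coercivity of the free Bloch blocks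
(`stub_freeBlochBlocksAllN`, constants `min_s h_k(s)`) and `stub_blochLatticeSum` at masses `m`, `0`
bound `Σ_k |Q_{k,m} − Q_{k,0}|`; (d) at `m = 0`, for `M ≠ 4` every block lies in exactly one of the
sibling's regions, `BlockMargins.blockMargin0/1/2/3a/3bAllN` give `Q_{k,0} ≥ g_k 𝒦` with
`g_k = γ(ns k) − 4·[corner]`, and the EXACT counting `stub_twistCountingAllM` (every `M ≥ 2`, `M ≠ 4`)
gives `Σ_k g_k ≥ M⁴/20000`; for `M = 4` the Bloch angles are `(2k+1)π/8` (`blochAngle_of_eq_four`)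
and `BlockMargins.blockMarginM4AllN` (certificate `stub_blockCertM4`) gives `g_k = 1/1000`,
`Σ_k g_k = M⁴/1000`; (e) the real bookkeeping `bookkeepingG` (the sibling's `bookkeepingW` with the
single counting hypothesis `M⁴/20000 ≤ Σ_k g_k` and mass slack `|m| (9 max C 0 + 5) ≤ 1/80000`)
leaves `(3/80000) M⁴ 𝒦 ≤ Σ_k Q_k`.  `N = 0` needs no separate treatment (all inputs hold for every `N`).
The helpers `coe_zeta_mul_omega` (for `Fin N`), `blochAngle_of_eq_four`, `bookkeepingG` are in
`…StubHessianMarginAssemblyAuxAllN`; `symbol_pos`, `shift_shift_self/comm` are the sibling's (`N`-free).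

Sources: Montvay–Münster, *Quantum Fields on a Lattice* §4.2 (Wilson fermions, hopping expansion);
the region margins rest on the sibling line's interval-arithmetic certificates (computational lane).
Pure theorem file (no `def`s).
-/

noncomputable section

open scoped BigOperators Classical Matrix ComplexConjugate
open Finset
open Literature.MathematicalPhysics.QuantumLattice Literature.MathematicalPhysics.QuantumFieldTheory

namespace Summit.QuantumFields.QCD.Cruxes.FlatCellOptimal.HessianMargin

open HessianMarginAllN
open Summit.QuantumFields.QCD.Cruxes.CriticalLineDiamagnetism.ChessboardCellGain (stub_blochLatticeSum)
open Summit.QuantumFields.QCD.Cruxes.CriticalLineDiamagnetism.ChessboardCellGain.CellGainCore (symbol_pos)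
open Summit.QuantumFields.QCD.Cruxes.CriticalLineDiamagnetism.ChessboardCellGain.TilingCombinatorics
  (shift_shift_self shift_shift_comm)
open Summit.QuantumFields.QCD.Cruxes.CriticalLineDiamagnetism.ChessboardCellGain.HessianMarginOf
  (re_trace_mul_self_of_conjTranspose im_trace_mul_self_of_conjTranspose hessian_gauge_invariance
    blochAngle_mem massCoeff_le)
open Summit.QuantumFields.QCD.Cruxes.FlatCellOptimal.WardKernel (stub_wardKernelAllN)
open Summit.QuantumFields.QCD.Cruxes.FlatCellOptimal.GaugeCoercive (gaugeCoercive)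
open Summit.QuantumFields.QCD.Cruxes.FlatCellOptimal.MassLipschitz (stub_massLipschitzAllN)
open Summit.QuantumFields.QCD.Cruxes.FlatCellOptimal.BlockMargins (blockMargin0AllN blockMargin1AllN
  blockMargin2AllN blockMargin3aAllN blockMargin3bAllN blockMarginM4AllN)
open Summit.QuantumFields.QCD.Cruxes.FlatCellOptimal.Tadpole (stub_tadpoleAllN)
open Summit.QuantumFields.QCD.Cruxes.FlatCellOptimal.FreeBlocks (stub_freeBlochBlocksAllN)
open Summit.QuantumFields.QCD.Cruxes.FlatCellOptimal.BilinearBounds (stub_bilinearBoundsAllN)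

/-- **G2 — `stub_hessianMarginAllN`: the one-loop Hessian margin for every `N` and every `M ≥ 2`**
(registered stub of skeleton v3; witnesses `c′ = 3/80000`, `ε = min ε_Σ (1/(80000 (9 max C_Σ 0 + 5)))`).
The finite-`M` one-loop Hessian form of the blocks,
`𝓗_M(Y) = ½ Σ_k 𝔅_k(Y,Y) + ½ Σ_μ T_μ Σ_x ‖Y(x,μ)‖_F²` (`T_μ = Σ_k ℓ_k(tst_μ)` the tadpole coefficient,
`tst_μ = (1/N)·1` on the link `(0, μ)`), dominates `c′ M⁴ Σ_p ‖curl Y_p‖_F²` on anti-Hermitian, tiling-odd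
block link fields, for every colour number `N`, every half-side `M ≥ 2` and `|m| ≤ ε`.  Composition of the
`N`-colour Ward kernel, gauge coercivity, mass Lipschitz bound, certified block margins (regions 0–3b and the
`M = 4` twists) and the exact twist counting; see the module docstring. -/
theorem stub_hessianMarginAllN : ∃ c' ε : ℝ, 0 < c' ∧ 0 < ε ∧ ∀ (N M : ℕ) [NeZero M], 2 ≤ M → ∀ (m : ℝ), |m| ≤ ε → ∀ (ω : Matrix.unitaryGroup (Fin N) ℂ) (ζ : (Fin 4 → Fin M) → Fin 4 → Matrix.unitaryGroup (Fin N) ℂ), ((ω : Matrix.unitaryGroup (Fin N) ℂ) : Matrix (Fin N) (Fin N) ℂ) = Complex.exp (↑(Real.pi / (2 * M : ℕ)) * Complex.I) • (1 : Matrix (Fin N) (Fin N) ℂ) → (∀ k μ, ((ζ k μ : Matrix.unitaryGroup (Fin N) ℂ) : Matrix (Fin N) (Fin N) ℂ) = Complex.exp (Real.pi * Complex.I * ((k μ : ℕ) : ℂ) / (M : ℂ)) • (1 : Matrix (Fin N) (Fin N) ℂ)) → ∀ (B0 : (Fin 4 → Fin M) → Matrix (Site 4 2 × Fin N × Fin 4)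 (Site 4 2 × Fin N × Fin 4) ℂ) (Dl : (Fin 4 → Fin M) → (Edge 4 2 → Matrix (Fin N) (Fin N) ℂ) → Matrix (Site 4 2 × Fin N × Fin 4) (Site 4 2 × Fin N × Fin 4) ℂ), (∀ k, B0 k = wilsonDirac (unitaryFundamentalRep (Fin N) ℂ) (fun e : Edge 4 2 => ζ k e.2 * ω) m 1) → (∀ k E, Dl k E = Matrix.of fun (p q : Site 4 2 × Fin N × Fin 4) => -(1 / 2 : ℂ) * ∑ μ : Fin 4, ((if q.1 = Site.shift p.1 μ then ((1 : Matrix (Fin 4) (Fin 4) ℂ) - euclideanGamma μ) p.2.2 q.2.2 * (((ζ k μ * ω : Matrix.unitaryGroup (Fin N) ℂ) : Matrix (Fin N) (Fin N) ℂ) * E (p.1, μ)) p.2.1 q.2.1 else 0) + (if p.1 = Site.shift q.1 μ then ((1 : Matrix (Fin 4) (Fin 4) ℂ) + euclideanGamma μ) p.2.2 q.2.2 * (((ζ k μ * ω : Matrix.unitaryGroup (Fin N) ℂ) : Matrix (Fin N) (Fin N) ℂ) * E (q.1, μ))ᴴ p.2.1 q.2.1 else 0))) → ∀ Y : Edge 4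 2 → Matrix (Fin N) (Fin N) ℂ, (∀ e, (Y e)ᴴ = -Y e) → (∀ (x : Site 4 2) (μ : Fin 4), Y (Site.shift x μ, μ) = -Y (x, μ)) → c' * (M : ℝ) ^ 4 * (∑ p : Plaquette 4 2, ∑ a, ∑ b, ‖(Y (p.1, p.2.1.1) + Y (Site.shift p.1 p.2.1.1, p.2.1.2) - Y (Site.shift p.1 p.2.1.2, p.2.1.1) - Y (p.1, p.2.1.2)) a b‖ ^ 2) ≤ (∑ k : Fin 4 → Fin M, ((B0 k)⁻¹ * Dl k Y * ((B0 k)⁻¹ * Dl k Y)).trace.re) / 2 + (∑ μ : Fin 4, (∑ k : Fin 4 → Fin M, ((B0 k)⁻¹ * Dl k (fun e : Edge 4 2 => if e = ((0 : Site 4 2), μ) then (1 / (N : ℂ)) • (1 : Matrix (Fin N) (Fin N) ℂ) else 0)).trace.re) * ∑ x : Site 4 2, ∑ a, ∑ b, ‖Y (x, μ) a b‖ ^ 2) / 2 := by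
  obtain ⟨CS, εS, hεS, hLS⟩ := stub_blochLatticeSum
  have hC5 : (0 : ℝ) < 9 * max CS 0 + 5 := by positivity
  refine ⟨3 / 80000, min εS (1 / (80000 * (9 * max CS 0 + 5))), by norm_num,
    lt_min hεS (by positivity), ?_⟩
  intro N M _ hM2 m hm ω ζ hω hζ B0 Dl hB0 hDl Y hYa hYo
  have hmS : |m| ≤ εS := hm.trans (min_le_left _ _)
  have hm5 : |m| * (9 * max CS 0 + 5) ≤ 1 / 80000 := by
    calc |m| * (9 * max CS 0 + 5)
        ≤ 1 / (80000 * (9 * max CS 0 + 5)) * (9 * max CS 0 + 5) :=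
          mul_le_mul_of_nonneg_right (hm.trans (min_le_right _ _)) hC5.le
      _ = 1 / 80000 := by field_simp
  -- (1) the Bloch phases of the blocks
  set θ : (Fin 4 → Fin M) → Fin 4 → ℝ := fun k μ =>
    Real.pi * ((k μ : ℕ) : ℝ) / M + Real.pi / (2 * M)
  have hu : ∀ (k : Fin 4 → Fin M) (μ : Fin 4),
      (((fun ν => ζ k ν * ω) μ : Matrix.unitaryGroup (Fin N) ℂ) : Matrix (Fin N) (Fin N) ℂ) =
        Complex.exp (↑(θ k μ) * Complex.I) • (1 : Matrix (Fin N) (Fin N) ℂ) :=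
    fun k μ => coe_zeta_mul_omega hω (hζ k μ)
  have hθk : ∀ (k : Fin 4 → Fin M) (μ : Fin 4), 0 < θ k μ ∧ θ k μ < Real.pi :=
    fun k μ => blochAngle_mem (k μ).isLt
  -- the free symbols at masses `m` and `0`, their minima, coercivity of the free blocks
  set hhm : (Fin 4 → Fin M) → (Fin 4 → ZMod 2) → ℝ := fun k s =>
    (m + ∑ μ : Fin 4, (1 - Real.cos (Real.pi * ((s μ).val : ℝ) + θ k μ))) ^ 2 +
      ∑ μ : Fin 4, Real.sin (Real.pi * ((s μ).val : ℝ) + θ k μ) ^ 2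
  set hh0 : (Fin 4 → Fin M) → (Fin 4 → ZMod 2) → ℝ := fun k s =>
    ((0 : ℝ) + ∑ μ : Fin 4, (1 - Real.cos (Real.pi * ((s μ).val : ℝ) + θ k μ))) ^ 2 +
      ∑ μ : Fin 4, Real.sin (Real.pi * ((s μ).val : ℝ) + θ k μ) ^ 2
  have hmin : ∀ f : (Fin 4 → ZMod 2) → ℝ, ∃ s₁, ∀ s, f s₁ ≤ f s := fun f => by
    obtain ⟨s₁, -, h⟩ := Finset.exists_min_image Finset.univ f Finset.univ_nonempty
    exact ⟨s₁, fun s => h s (Finset.mem_univ s)⟩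
  choose sm hsm using fun k => hmin (hhm k)
  choose s0 hs0 using fun k => hmin (hh0 k)
  set cm : (Fin 4 → Fin M) → ℝ := fun k => hhm k (sm k)
  set c0 : (Fin 4 → Fin M) → ℝ := fun k => hh0 k (s0 k)
  have hcm : ∀ k, 0 < cm k := fun k => symbol_pos m k (sm k)
  have hc0 : ∀ k, 0 < c0 k := fun k => symbol_pos 0 k (s0 k)
  -- the mass-`0` blocks `B_z(k)`
  obtain ⟨Bz, hBz⟩ : ∃ Bz : (Fin 4 → Fin M) →
      Matrix (Site 4 2 × Fin N × Fin 4) (Site 4 2 × Fin N × Fin 4) ℂ, ∀ k, Bz k =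
        wilsonDirac (unitaryFundamentalRep (Fin N) ℂ) (fun e : Edge 4 2 => ζ k e.2 * ω) 0 1 :=
    ⟨_, fun _ => rfl⟩
  have hcoem : ∀ (k : Fin 4 → Fin M) (v : Site 4 2 × Fin N × Fin 4 → ℂ),
      cm k * ∑ i, ‖v i‖ ^ 2 ≤ ∑ i, ‖((B0 k).mulVec v) i‖ ^ 2 := fun k =>
    (stub_freeBlochBlocksAllN N (θ k) m (fun ν => ζ k ν * ω) (hu k) (B0 k) (hhm k) (hB0 k)
      (fun _ => rfl)).2 (cm k) (hsm k)
  have hcoe0 : ∀ (k : Fin 4 → Fin M) (v : Site 4 2 × Fin N × Fin 4 → ℂ),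
      c0 k * ∑ i, ‖v i‖ ^ 2 ≤ ∑ i, ‖((Bz k).mulVec v) i‖ ^ 2 := fun k =>
    (stub_freeBlochBlocksAllN N (θ k) 0 (fun ν => ζ k ν * ω) (hu k) (Bz k) (hh0 k) (hBz k)
      (fun _ => rfl)).2 (c0 k) (hs0 k)
  have hLSm : ∑ k, Real.sqrt (cm k) / cm k ^ 2 ≤ CS * (M : ℝ) ^ 4 :=
    calc ∑ k, Real.sqrt (cm k) / cm k ^ 2
        ≤ ∑ k : Fin 4 → Fin M, ∑ s : Fin 4 → ZMod 2, Real.sqrt (hhm k s) / hhm k s ^ 2 :=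
          Finset.sum_le_sum fun k _ => Finset.single_le_sum
            (f := fun s => Real.sqrt (hhm k s) / hhm k s ^ 2)
            (fun s _ => div_nonneg (Real.sqrt_nonneg _) (sq_nonneg _)) (Finset.mem_univ (sm k))
      _ ≤ CS * (M : ℝ) ^ 4 := hLS M m hmS
  have hLS0 : ∑ k, Real.sqrt (c0 k) / c0 k ^ 2 ≤ CS * (M : ℝ) ^ 4 :=
    calc ∑ k, Real.sqrt (c0 k) / c0 k ^ 2
        ≤ ∑ k : Fin 4 → Fin M, ∑ s : Fin 4 → ZMod 2, Real.sqrt (hh0 k s) / hh0 k s ^ 2 :=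
          Finset.sum_le_sum fun k _ => Finset.single_le_sum
            (f := fun s => Real.sqrt (hh0 k s) / hh0 k s ^ 2)
            (fun s _ => div_nonneg (Real.sqrt_nonneg _) (sq_nonneg _)) (Finset.mem_univ (s0 k))
      _ ≤ CS * (M : ℝ) ^ 4 := hLS M 0 (by rw [abs_zero]; exact hεS.le)
  -- (2) the tadpole: the right side is `Σ_k Q_k(Y)`
  have him : ∀ μ : Fin 4, (∑ x : Site 4 2, (Y (x, μ) * Y (x, μ)).trace).im = 0 := fun μ => by
    rw [Complex.im_sum]
    exact Finset.sum_eq_zero fun x _ => im_trace_mul_self_of_conjTranspose _ (hYa _)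
  have hre : ∀ μ : Fin 4, (∑ x : Site 4 2, (Y (x, μ) * Y (x, μ)).trace).re =
      -∑ x : Site 4 2, ∑ a, ∑ b, ‖Y (x, μ) a b‖ ^ 2 := fun μ => by
    rw [Complex.re_sum, ← Finset.sum_neg_distrib]
    exact Finset.sum_congr rfl fun x _ => re_trace_mul_self_of_conjTranspose _ (hYa _)
  set KY : ℝ := ∑ p : Plaquette 4 2, ∑ a, ∑ b, ‖(Y (p.1, p.2.1.1) +
    Y (Site.shift p.1 p.2.1.1, p.2.1.2) - Y (Site.shift p.1 p.2.1.2, p.2.1.1) -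
      Y (p.1, p.2.1.2)) a b‖ ^ 2 with hKY_def
  -- the tadpole coefficients `Tk k μ = ℓ_k(tst_μ)`
  set Tk : (Fin 4 → Fin M) → Fin 4 → ℝ := fun k μ => ((B0 k)⁻¹ * Dl k (fun e : Edge 4 2 =>
    if e = ((0 : Site 4 2), μ) then (1 / (N : ℂ)) • (1 : Matrix (Fin N) (Fin N) ℂ) else 0)).trace.re
    with hTk_def
  have hTk : ∀ k : Fin 4 → Fin M, ((B0 k)⁻¹ * Dl k (fun e => Y e * Y e)).trace.re =
      ∑ μ : Fin 4, Tk k μ * (∑ x : Site 4 2, (Y (x, μ) * Y (x, μ)).trace).re := fun k =>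
    stub_tadpoleAllN N m (θ k) (fun ν => ζ k ν * ω) (hu k) (B0 k) (Dl k) (hB0 k) (hDl k)
      (fun e => Y e * Y e) him
  have hRHS : (∑ k : Fin 4 → Fin M, ((B0 k)⁻¹ * Dl k Y * ((B0 k)⁻¹ * Dl k Y)).trace.re) / 2 +
      (∑ μ : Fin 4, (∑ k : Fin 4 → Fin M, Tk k μ) *
        ∑ x : Site 4 2, ∑ a, ∑ b, ‖Y (x, μ) a b‖ ^ 2) / 2 =
      ∑ k : Fin 4 → Fin M, (((B0 k)⁻¹ * Dl k Y * ((B0 k)⁻¹ * Dl k Y)).trace.re / 2 -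
        ((B0 k)⁻¹ * Dl k (fun e => Y e * Y e)).trace.re / 2) := by
    have h2 : ∀ k : Fin 4 → Fin M, ((B0 k)⁻¹ * Dl k (fun e => Y e * Y e)).trace.re =
        -∑ μ : Fin 4, Tk k μ * ∑ x : Site 4 2, ∑ a, ∑ b, ‖Y (x, μ) a b‖ ^ 2 := fun k => by
      rw [hTk k, ← Finset.sum_neg_distrib]
      exact Finset.sum_congr rfl fun μ _ => by rw [hre μ, mul_neg]
    have h1 : ∑ k : Fin 4 → Fin M, ((B0 k)⁻¹ * Dl k (fun e => Y e * Y e)).trace.re =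
        -∑ μ : Fin 4, (∑ k : Fin 4 → Fin M, Tk k μ) *
          ∑ x : Site 4 2, ∑ a, ∑ b, ‖Y (x, μ) a b‖ ^ 2 :=
      calc ∑ k : Fin 4 → Fin M, ((B0 k)⁻¹ * Dl k (fun e => Y e * Y e)).trace.re
          = ∑ k : Fin 4 → Fin M, -∑ μ : Fin 4,
              Tk k μ * ∑ x : Site 4 2, ∑ a, ∑ b, ‖Y (x, μ) a b‖ ^ 2 :=
            Finset.sum_congr rfl fun k _ => h2 k
        _ = -∑ μ : Fin 4, ∑ k : Fin 4 → Fin M,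
              Tk k μ * ∑ x : Site 4 2, ∑ a, ∑ b, ‖Y (x, μ) a b‖ ^ 2 := by
            rw [Finset.sum_neg_distrib, Finset.sum_comm]
        _ = -∑ μ : Fin 4, (∑ k : Fin 4 → Fin M, Tk k μ) *
              ∑ x : Site 4 2, ∑ a, ∑ b, ‖Y (x, μ) a b‖ ^ 2 :=
            congrArg Neg.neg (Finset.sum_congr rfl fun μ _ => (Finset.sum_mul _ _ _).symm)
    rw [Finset.sum_sub_distrib, ← Finset.sum_div, ← Finset.sum_div, h1]
    ring
  change 3 / 80000 * (M : ℝ) ^ 4 * KY ≤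
    (∑ k : Fin 4 → Fin M, ((B0 k)⁻¹ * Dl k Y * ((B0 k)⁻¹ * Dl k Y)).trace.re) / 2 +
      (∑ μ : Fin 4, (∑ k : Fin 4 → Fin M, Tk k μ) *
        ∑ x : Site 4 2, ∑ a, ∑ b, ‖Y (x, μ) a b‖ ^ 2) / 2
  rw [hRHS]
  -- (3) the gauge: `Y' = Y − dλ`, `8‖Y'‖² ≤ 𝒦(Y) = 𝒦(Y')`, `Q_k(Y) = Q_k(Y')`
  obtain ⟨lam, hlam, hcoer⟩ := gaugeCoercive Y hYa hYo
  set D : Edge 4 2 → Matrix (Fin N) (Fin N) ℂ := fun e => lam e.1 - lam (Site.shift e.1 e.2)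
    with hD_def
  set Y' : Edge 4 2 → Matrix (Fin N) (Fin N) ℂ := fun e =>
    Y e - (lam e.1 - lam (Site.shift e.1 e.2)) with hY'_def
  set KY' : ℝ := ∑ p : Plaquette 4 2, ∑ a, ∑ b, ‖(Y' (p.1, p.2.1.1) +
    Y' (Site.shift p.1 p.2.1.1, p.2.1.2) - Y' (Site.shift p.1 p.2.1.2, p.2.1.1) -
      Y' (p.1, p.2.1.2)) a b‖ ^ 2 with hKY'_def
  set nY' : ℝ := ∑ e : Edge 4 2, ∑ a, ∑ b, ‖Y' e a b‖ ^ 2 with hnY'_def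
  have h8 : 8 * nY' ≤ KY := hcoer
  have hnY'0 : 0 ≤ nY' := by
    rw [hnY'_def]
    positivity
  have hY'a : ∀ e, (Y' e)ᴴ = -Y' e := fun e => by
    simp only [hY'_def, Matrix.conjTranspose_sub, hYa, hlam]
    abel
  have hDa : ∀ e, (D e)ᴴ = -D e := fun e => by
    simp only [hD_def, Matrix.conjTranspose_sub, hlam]
    abel
  have hY'o : ∀ (x : Site 4 2) (μ : Fin 4), Y' (Site.shift x μ, μ) = -Y' (x, μ) :=
    fun x μ => by
    simp only [hY'_def, shift_shift_self]
    rw [hYo]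
    abel
  have hcurl : ∀ p : Plaquette 4 2, Y' (p.1, p.2.1.1) + Y' (Site.shift p.1 p.2.1.1, p.2.1.2) -
      Y' (Site.shift p.1 p.2.1.2, p.2.1.1) - Y' (p.1, p.2.1.2) = Y (p.1, p.2.1.1) +
      Y (Site.shift p.1 p.2.1.1, p.2.1.2) - Y (Site.shift p.1 p.2.1.2, p.2.1.1) - Y (p.1, p.2.1.2) :=
    fun p => by
    simp only [hY'_def, shift_shift_comm p.1 p.2.1.2 p.2.1.1]
    abel
  have hKY' : KY' = KY := by
    rw [hKY'_def, hKY_def]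
    exact Finset.sum_congr rfl fun p _ => by rw [hcurl p]
  have hDl_add : ∀ (k : Fin 4 → Fin M) (E₁ E₂ : Edge 4 2 → Matrix (Fin N) (Fin N) ℂ),
      Dl k (E₁ + E₂) = Dl k E₁ + Dl k E₂ := fun k =>
    (stub_bilinearBoundsAllN N m (fun ν => ζ k ν * ω) (cm k) (hcm k) (B0 k) (Dl k) (hB0 k)
      (hDl k) (hcoem k)).1
  have hgauge : ∀ k : Fin 4 → Fin M,
      ((B0 k)⁻¹ * Dl k Y * ((B0 k)⁻¹ * Dl k Y)).trace.re / 2 -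
          ((B0 k)⁻¹ * Dl k (fun e => Y e * Y e)).trace.re / 2 =
        ((B0 k)⁻¹ * Dl k Y' * ((B0 k)⁻¹ * Dl k Y')).trace.re / 2 -
          ((B0 k)⁻¹ * Dl k (fun e => Y' e * Y' e)).trace.re / 2 := fun k =>
    hessian_gauge_invariance ((B0 k)⁻¹) (Dl k) (hDl_add k) Y D
      (stub_wardKernelAllN N m (θ k) (fun ν => ζ k ν * ω) (hu k) (B0 k) (Dl k) (hB0 k) (hDl k)
        Y' lam hY'a hlam)
      (stub_wardKernelAllN N m (θ k) (fun ν => ζ k ν * ω) (hu k) (B0 k) (Dl k) (hB0 k) (hDl k)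
        D lam hDa hlam)
  -- (4) the mass: `|Q_{k,m}(Y') − Q_{k,0}(Y')| ≤ |m| β_k ‖Y'‖²`, `β_k ≤ 36 (t_m + t_0) + 40`
  set Q0 : (Fin 4 → Fin M) → ℝ := fun k =>
    ((Bz k)⁻¹ * Dl k Y' * ((Bz k)⁻¹ * Dl k Y')).trace.re / 2 -
      ((Bz k)⁻¹ * Dl k (fun e => Y' e * Y' e)).trace.re / 2
  set β : (Fin 4 → Fin M) → ℝ := fun k =>
    16 / (cm k * Real.sqrt (c0 k)) + 16 / (c0 k * Real.sqrt (cm k)) +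
      40 / (Real.sqrt (cm k) * Real.sqrt (c0 k))
  have hmass : ∀ k : Fin 4 → Fin M,
      |(((B0 k)⁻¹ * Dl k Y * ((B0 k)⁻¹ * Dl k Y)).trace.re / 2 -
          ((B0 k)⁻¹ * Dl k (fun e => Y e * Y e)).trace.re / 2) - Q0 k| ≤ |m| * β k * nY' :=
    fun k => by
    rw [hgauge k]
    exact stub_massLipschitzAllN N m (fun ν => ζ k ν * ω) (cm k) (c0 k) (hcm k) (hc0 k) (B0 k)
      (Bz k) (Dl k) (hB0 k) (hBz k) (hDl k) (hcoem k) (hcoe0 k) Y'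
  have hβ : ∀ k : Fin 4 → Fin M,
      β k ≤ 36 * (Real.sqrt (cm k) / cm k ^ 2 + Real.sqrt (c0 k) / c0 k ^ 2) + 40 :=
    fun k => massCoeff_le (hcm k) (hc0 k)
  -- (5) the regions at mass `0`: `M ≠ 4` by the sibling's regions and the exact counting, `M = 4` apart
  have hKY'0 : 0 ≤ KY' := hKY'.symm ▸ (mul_nonneg (by norm_num : (0 : ℝ) ≤ 8) hnY'0).trans h8
  have hcard : ∑ _k : Fin 4 → Fin M, (1 : ℝ) = (M : ℝ) ^ 4 := by
    rw [Finset.sum_const, Finset.card_univ, Fintype.card_fun, Fintype.card_fin, Fintype.card_fin,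
      nsmul_eq_mul, mul_one, Nat.cast_pow]
  have hM4pos : (0 : ℝ) ≤ (M : ℝ) ^ 4 := by positivity
  obtain ⟨g, hPk, hG⟩ : ∃ g : (Fin 4 → Fin M) → ℝ, (∀ k, g k * KY ≤ Q0 k) ∧
      1 / 20000 * (M : ℝ) ^ 4 ≤ ∑ k, g k := by
    by_cases hM4 : M = 4
    · -- `M = 4`: every block carries the certified margin `1/1000` (`blockMarginM4AllN`)
      refine ⟨fun _ => 1 / 1000, fun k => ?_, ?_⟩
      · have hP : 1 / 1000 * KY' ≤ Q0 k :=
          blockMarginM4AllN N (θ k) (fun μ => blochAngle_of_eq_four hM4 (k μ).isLt)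
            (fun ν => ζ k ν * ω) (hu k) (Bz k) (Dl k) (hBz k) (hDl k) Y' hY'a hY'o
        rw [← hKY']
        exact hP
      · have hs : ∑ _k : Fin 4 → Fin M, (1 / 1000 : ℝ) = 1 / 1000 * (M : ℝ) ^ 4 := by
          rw [← hcard, Finset.mul_sum, mul_one]
        rw [hs]
        linarith
    · -- `M ≠ 4`: the regions 0, 1, 2, 3a, 3b with `g_k = γ(ns k) − 4·[corner k]`
      set ns : (Fin 4 → Fin M) → ℕ := fun k =>
        (Finset.univ.filter (fun μ : Fin 4 => min (θ k μ) (Real.pi - θ k μ) < 1 / 2)).card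
      set ic : (Fin 4 → Fin M) → ℝ := fun k =>
        if (∀ μ : Fin 4, min (θ k μ) (Real.pi - θ k μ) < 1 / 20) then 1 else 0 with hic_def
      have hic0 : ∀ k, 0 ≤ ic k := fun k => by
        simp only [hic_def]
        split_ifs <;> norm_num
      set g : (Fin 4 → Fin M) → ℝ := fun k =>
        3 / 2500 * (if ns k = 0 then 1 else 0) + 13 / 20000 * (if ns k = 1 then 1 else 0) -
          1 / 4000 * (if ns k = 2 then 1 else 0) - 1 / 1000 * (if 3 ≤ ns k then 1 else 0) -
            4 * ic k with hg_def
      refine ⟨g, fun k => ?_, ?_⟩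
      · rw [← hKY']
        rcases (show ns k = 0 ∨ ns k = 1 ∨ ns k = 2 ∨ 3 ≤ ns k by omega) with h | h | h | h
        · have hP : 3 / 2500 * KY' ≤ Q0 k :=
            blockMargin0AllN N (θ k) (hθk k) h (fun ν => ζ k ν * ω) (hu k) (Bz k) (Dl k) (hBz k)
              (hDl k) Y' hY'a hY'o
          have hg : g k ≤ 3 / 2500 := by
            have : g k = 3 / 2500 - 4 * ic k := by
              simp only [hg_def, h]
              norm_num
            linarith [hic0 k]
          exact (mul_le_mul_of_nonneg_right hg hKY'0).trans hP
        · have hP : 13 / 20000 * KY' ≤ Q0 k :=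
            blockMargin1AllN N (θ k) (hθk k) h (fun ν => ζ k ν * ω) (hu k) (Bz k) (Dl k) (hBz k)
              (hDl k) Y' hY'a hY'o
          have hg : g k ≤ 13 / 20000 := by
            have : g k = 13 / 20000 - 4 * ic k := by
              simp only [hg_def, h]
              norm_num
            linarith [hic0 k]
          exact (mul_le_mul_of_nonneg_right hg hKY'0).trans hP
        · have hP : -(1 / 4000) * KY' ≤ Q0 k :=
            blockMargin2AllN N (θ k) (hθk k) h (fun ν => ζ k ν * ω) (hu k) (Bz k) (Dl k) (hBz k)
              (hDl k) Y' hY'a hY'o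
          have hg : g k ≤ -(1 / 4000) := by
            have : g k = -(1 / 4000) - 4 * ic k := by
              simp only [hg_def, h]
              norm_num
            linarith [hic0 k]
          exact (mul_le_mul_of_nonneg_right hg hKY'0).trans hP
        · have hg' : g k = -(1 / 1000) - 4 * ic k := by
            simp only [hg_def, if_neg (by omega : ¬ns k = 0), if_neg (by omega : ¬ns k = 1),
              if_neg (by omega : ¬ns k = 2), if_pos h]
            norm_num
          by_cases hc : ∀ μ : Fin 4, min (θ k μ) (Real.pi - θ k μ) < 1 / 20
          · have hP : -(4 : ℝ) * KY' ≤ Q0 k :=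
              blockMargin3bAllN N (θ k) (hθk k) hc (fun ν => ζ k ν * ω) (hu k) (Bz k) (Dl k)
                (hBz k) (hDl k) Y' hY'a hY'o
            have hic : ic k = 1 := by simp only [hic_def, if_pos hc]
            have hg : g k ≤ -(4 : ℝ) := by linarith
            exact (mul_le_mul_of_nonneg_right hg hKY'0).trans hP
          · have hP : -(1 / 1000) * KY' ≤ Q0 k :=
              blockMargin3aAllN N (θ k) (hθk k) h hc (fun ν => ζ k ν * ω) (hu k) (Bz k) (Dl k)
                (hBz k) (hDl k) Y' hY'a hY'o
            have hic : ic k = 0 := by simp only [hic_def, if_neg hc]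
            have hg : g k ≤ -(1 / 1000) := by linarith
            exact (mul_le_mul_of_nonneg_right hg hKY'0).trans hP
      · have hic_sum : ∑ k, ic k = ((Finset.univ.filter (fun k : Fin 4 → Fin M =>
            ∀ μ : Fin 4, min (θ k μ) (Real.pi - θ k μ) < 1 / 20)).card : ℝ) := by
          simp only [hic_def, Finset.sum_boole]
        have hg_sum : ∑ k, g k =
            3 / 2500 * ((Finset.univ.filter (fun k : Fin 4 → Fin M => ns k = 0)).card : ℝ) +
            13 / 20000 * ((Finset.univ.filter (fun k : Fin 4 → Fin M => ns k = 1)).card : ℝ) -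
            1 / 4000 * ((Finset.univ.filter (fun k : Fin 4 → Fin M => ns k = 2)).card : ℝ) -
            1 / 1000 * ((Finset.univ.filter (fun k : Fin 4 → Fin M => 3 ≤ ns k)).card : ℝ) -
            4 * ((Finset.univ.filter (fun k : Fin 4 → Fin M =>
              ∀ μ : Fin 4, min (θ k μ) (Real.pi - θ k μ) < 1 / 20)).card : ℝ) := by
          rw [← hic_sum]
          simp only [hg_def, Finset.sum_add_distrib, Finset.sum_sub_distrib, ← Finset.mul_sum,
            Finset.sum_boole]
        rw [hg_sum]
        exact stub_twistCountingAllM M hM2 hM4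
  -- (6) bookkeeping
  exact bookkeepingG hmass hPk hβ hLSm hLS0 hcard h8 hnY'0 hG hm5 hM4pos

end Summit.QuantumFields.QCD.Cruxes.FlatCellOptimal.HessianMargin

end
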